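import Summits.HubbardSuperconductivity.HubbardSuperconductivity.Theorems.LevyLogBootstrapDressHalfFilledPairResolventFamilyCertificate
import Summits.HubbardSuperconductivity.HubbardSuperconductivity.Theorems.LevyLogBootstrapDressHalfFilledSectorArrayPush
import Summits.HubbardSuperconductivity.HubbardSuperconductivity.Theorems.CooperPairDMottWalkPlaquetteTables
import Literature.MathematicalPhysics.QuantumLattice.ApproximateEigenvectorLemmas
import HarnessLib

/-!
# Crux `DressHalfFilled` (stmt-HubbardSuperconductivity-8148), stub `stub_plaquetteData`, certificate (W1) at `U = 2`:
# the family certificate EVALUATED IN SECTOR COORDINATES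

Support file (`--supports stmt-HubbardSuperconductivity-8148`), continuing `…PairResolventFamilyCertificate`: all vectors of
the (W1) certificates are pushed array vectors `Γ (ofSectorArray sa sb w)` of two plaquette sectors (Lieb coordinates of
the `Fin 4` model, `TwoSpeciesSectorArrays`); with the trial matrix `Y = Σ_J (Γ y_J)(Γ e_J)ᵀ` over the pushed elementary
arrays of the second sector, pairing, Sylvester residual and Frobenius norms become INTEGER sums (`sector_family_certificate`:
the kernel evaluates `P`, `R`, `Yn`). Sources: T. Kato (1966) I-§5.3; E. H. Lieb, PRL 62 (1989) 1201, eq. (4). No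
definition and no named fact is introduced; sorry-free.
-/

noncomputable section

set_option linter.dupNamespace false

namespace Summit.HubbardSuperconductivity.HubbardSuperconductivity.Theorems.LevyLogBootstrap

open Matrix Finset Literature.MathematicalPhysics.QuantumLattice Literature.MathematicalPhysics.QuantumLattice.TwoSpecies
open Summit.HubbardSuperconductivity.HubbardSuperconductivity.Theorems.CooperPairDMottWalk
open scoped ComplexOrder

/-! ### Array vectors of the plaquette: inner products, expansion, `H`-images -/

section Arrays

variable {a b p q : ℕ} {sa : Fin p → Finset (Fin 4)} {sb : Fin q → Finset (Fin 4)}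
/-- `⟨Γ w, Γ w'⟩ = Σ conj w w'` on one sector. [folklore] -/
theorem star_gamArray_dotProduct (ha : IsSubsetEnum a sa) (hb : IsSubsetEnum b sb) (w w' : Fin p → Fin q → ℂ) :
    star (gam *ᵥ ofSectorArray sa sb w) ⬝ᵥ (gam *ᵥ ofSectorArray sa sb w') = ∑ i, ∑ j, star (w i j) * w' i j := by
  rw [star_relabelMatrix_mulVec_dotProduct, star_ofSectorArray_dotProduct ha hb]
/-- Squared norm of a pushed integer array vector: `‖Γ w‖² = Σ w_{ij}²`. [folklore] -/
theorem eucNorm_gamArray_int_sq (ha : IsSubsetEnum a sa) (hb : IsSubsetEnum b sb) (w : Fin p → Fin q → ℤ) :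
    eucNorm (gam *ᵥ ofSectorArray sa sb (fun i j => ((w i j : ℤ) : ℂ))) ^ 2 = ((∑ i, ∑ j, w i j ^ 2 : ℤ) : ℝ) := by
  rw [eucNorm_sq, star_gamArray_dotProduct ha hb]
  push_cast
  simp only [Complex.re_sum]
  refine Finset.sum_congr rfl fun i _ => Finset.sum_congr rfl fun j _ => ?_
  rw [Complex.star_def, ← Complex.ofReal_intCast, Complex.conj_ofReal, ← Complex.ofReal_mul, Complex.ofReal_re, sq]
/-- A pushed array vector lies in its sector. [folklore] -/
theorem isInSector_gamArray (ha : IsSubsetEnum a sa) (hb : IsSubsetEnum b sb) (w : Fin p → Fin q → ℂ) :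
    IsInSector a b (gam *ᵥ ofSectorArray sa sb w) :=
  isInSector_relabelMatrix_mulVec siteEquiv (isInSector_ofSectorArray ha hb w)
/-- Linearity: `Γ (ofSectorArray (Σ_J c_J • w_J)) = Σ_J c_J • Γ (ofSectorArray w_J)`. [folklore] -/
theorem gamArray_sum_smul {κ : Type*} [Fintype κ] (c : κ → ℂ) (w : κ → Fin p → Fin q → ℂ) :
    gam *ᵥ ofSectorArray sa sb (∑ J, c J • w J) = ∑ J, c J • (gam *ᵥ ofSectorArray sa sb (w J)) := by
  rw [ofSectorArray_sum, mulVec_sum]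
  refine Finset.sum_congr rfl fun J _ => ?_
  rw [ofSectorArray_smul, mulVec_smul]
/-- **Expansion in the pushed elementary arrays**: `Γ w = Σ_J w_J • Γ e_J`. [folklore] -/
theorem gamArray_expand (w : Fin p → Fin q → ℂ) :
    gam *ᵥ ofSectorArray sa sb w =
      ∑ J : Fin p × Fin q, w J.1 J.2 • (gam *ᵥ ofSectorArray sa sb (fun i j => if i = J.1 ∧ j = J.2 then (1 : ℂ) else 0)) := by
  conv_lhs => rw [sectorArray_eq_sum_elementary w]
  exact gamArray_sum_smul _ _
/-- **Orthonormality of the pushed elementary arrays.** [folklore] -/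
theorem gamArray_elementary_orthonormal (ha : IsSubsetEnum a sa) (hb : IsSubsetEnum b sb) (J J' : Fin p × Fin q) :
    star (gam *ᵥ ofSectorArray sa sb (fun i j => if i = J.1 ∧ j = J.2 then (1 : ℂ) else 0)) ⬝ᵥ
        (gam *ᵥ ofSectorArray sa sb (fun i j => if i = J'.1 ∧ j = J'.2 then (1 : ℂ) else 0)) =
      if J = J' then 1 else 0 := by
  rw [star_gamArray_dotProduct ha hb]
  simp only [apply_ite star, star_one, star_zero, ite_mul, one_mul, zero_mul]
  by_cases h : J = J'
  · subst h
    rw [if_pos rfl]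
    have : ∀ i : Fin p, (∑ j : Fin q, if i = J.1 ∧ j = J.2 then (if i = J.1 ∧ j = J.2 then (1 : ℂ) else 0) else 0) =
        if i = J.1 then 1 else 0 := by
      intro i
      by_cases hi : i = J.1
      · simp [hi]
      · simp [hi]
    simp only [this, Finset.sum_ite_eq', Finset.mem_univ, if_true]
  · rw [if_neg h]
    refine Finset.sum_eq_zero fun i _ => Finset.sum_eq_zero fun j _ => ?_
    by_cases h1 : i = J.1 ∧ j = J.2
    · have h2 : ¬ (i = J'.1 ∧ j = J'.2) := by
        rintro ⟨h3, h4⟩; exact h (Prod.ext (h1.1.symm.trans h3) (h1.2.symm.trans h4))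
      rw [if_pos h1, if_neg h2]
    · rw [if_neg h1]
/-- **The coordinate array of a pushed elementary array under `H(U)`**: with hopping tables `Ka`, `Kb` and the double
occupancies `d` of the sector, `H(U) Γ e_J = Σ_{J'} M_{J' J} Γ e_{J'}`,
`M_{J' J} = Ka_{J'.1 J.1} [J'.2 = J.2] + Kb_{J'.2 J.2} [J'.1 = J.1] + U d_{J} [J' = J]`. [folklore] -/
theorem plaquetteHamiltonian_mulVec_gamArray_elementary (ha : IsSubsetEnum a sa) (hb : IsSubsetEnum b sb) (U : ℝ)
    {Ka : Fin p → Fin p → ℤ} {Kb : Fin q → Fin q → ℤ} {d : Fin p → Fin q → ℕ}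
    (hKa : ∀ i i', hoppingMatrix plaqGraph4 1 (sa i) (sa i') = (Ka i i' : ℂ))
    (hKb : ∀ j j', hoppingMatrix plaqGraph4 1 (sb j) (sb j') = (Kb j j' : ℂ))
    (hd : ∀ i j, (sa i ∩ sb j).card = d i j) (J : Fin p × Fin q) :
    plaquetteHamiltonian U *ᵥ (gam *ᵥ ofSectorArray sa sb (fun i j => if i = J.1 ∧ j = J.2 then (1 : ℂ) else 0)) =
      ∑ J' : Fin p × Fin q, ((Ka J'.1 J.1 : ℂ) * (if J'.2 = J.2 then 1 else 0) +
          (Kb J'.2 J.2 : ℂ) * (if J'.1 = J.1 then 1 else 0) +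
          (U : ℂ) * (d J.1 J.2 : ℂ) * (if J' = J then 1 else 0)) •
        (gam *ᵥ ofSectorArray sa sb (fun i j => if i = J'.1 ∧ j = J'.2 then (1 : ℂ) else 0)) := by
  rw [plaquetteHamiltonian_mulVec_push, hamiltonian_mulVec_ofSectorArray plaqGraph4 ha hb 1 U hKa hKb hd, gamArray_expand]
  refine Finset.sum_congr rfl fun J' _ => ?_
  congr 1
  have h1 : (∑ i', (Ka J'.1 i' : ℂ) * (if i' = J.1 ∧ J'.2 = J.2 then (1 : ℂ) else 0)) =
      (Ka J'.1 J.1 : ℂ) * (if J'.2 = J.2 then 1 else 0) := by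
    by_cases h : J'.2 = J.2
    · simp [h]
    · simp [h]
  have h2 : (∑ j', (Kb J'.2 j' : ℂ) * (if J'.1 = J.1 ∧ j' = J.2 then (1 : ℂ) else 0)) =
      (Kb J'.2 J.2 : ℂ) * (if J'.1 = J.1 then 1 else 0) := by
    by_cases h : J'.1 = J.1
    · simp [h]
    · simp [h]
  rw [h1, h2]
  by_cases hJ : J' = J
  · subst hJ; simp
  · have : ¬ (J'.1 = J.1 ∧ J'.2 = J.2) := fun hc => hJ (Prod.ext hc.1 hc.2)
    rw [if_neg this, if_neg hJ]
    simp
/-- Block invariance of the plaquette Hamiltonian in the coordinate form used by the Sylvester certificate: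
no entries from outside the sector `(a, b)` into it. [folklore] -/
theorem plaquetteHamiltonian_block (U : ℝ) (a b : ℕ) :
    ∀ j k : Finset (Orb PlaquetteSite), ¬ ((upPart j).card = a ∧ (downPart j).card = b) →
      ((upPart k).card = a ∧ (downPart k).card = b) → plaquetteHamiltonian U j k = 0 := by
  intro j k hj hk
  by_contra hne
  have h := LiebThm1.preservesSectors_hamiltonian plaquetteGraph 1 U j k hne
  exact hj ⟨h.1.trans hk.1, h.2.trans hk.2⟩
/-- Row action of the sector matrix `M_{J J'} = Ka_{J.1 J'.1}[J.2 = J'.2] + Kb_{J.2 J'.2}[J.1 = J'.1] + U d_{J'}[J = J']` on a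
table `g`: `Σ_{J'} M_{J J'} g_{J'} = Σ_{i₂} Ka_{J.1 i₂} g_{i₂ J.2} + Σ_{j₂} Kb_{J.2 j₂} g_{J.1 j₂} + U d_J g_J`. [folklore] -/
theorem sum_sectorMatrix_apply {p q : ℕ} (Ka : Fin p → Fin p → ℤ) (Kb : Fin q → Fin q → ℤ) (d : Fin p → Fin q → ℕ)
    (U : ℂ) (g : Fin p → Fin q → ℂ) (J : Fin p × Fin q) :
    (∑ J' : Fin p × Fin q, ((Ka J.1 J'.1 : ℂ) * (if J.2 = J'.2 then 1 else 0) +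
        (Kb J.2 J'.2 : ℂ) * (if J.1 = J'.1 then 1 else 0) + U * (d J'.1 J'.2 : ℂ) * (if J = J' then 1 else 0)) *
        g J'.1 J'.2) =
      (∑ i₂, (Ka J.1 i₂ : ℂ) * g i₂ J.2) + (∑ j₂, (Kb J.2 j₂ : ℂ) * g J.1 j₂) + U * (d J.1 J.2 : ℂ) * g J.1 J.2 := by
  simp only [add_mul, Finset.sum_add_distrib]
  congr 1
  congr 1
  · rw [Fintype.sum_prod_type]
    refine Finset.sum_congr rfl fun i₂ _ => ?_
    simp only [mul_ite, mul_one, mul_zero, ite_mul, zero_mul]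
    rw [Finset.sum_ite_eq, if_pos (Finset.mem_univ _)]
  · rw [Fintype.sum_prod_type, Finset.sum_eq_single J.1]
    · refine Finset.sum_congr rfl fun j₂ _ => ?_
      simp
    · intro i₂ _ hi₂
      refine Finset.sum_eq_zero fun j₂ _ => ?_
      rw [if_neg (Ne.symm hi₂)]; simp
    · intro h; exact absurd (Finset.mem_univ _) h
  · rw [Finset.sum_eq_single J]
    · simp
    · intro J' _ hJ'
      rw [if_neg (Ne.symm hJ')]; simp
    · intro h; exact absurd (Finset.mem_univ _) h

end Arrays

/-! ### The family certificate in sector coordinates -/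

section Certificate

variable {p₁ q₁ p₂ q₂ a₁ b₁ a₂ b₂ : ℕ}
  {sa₁ : Fin p₁ → Finset (Fin 4)} {sb₁ : Fin q₁ → Finset (Fin 4)}
  {sa₂ : Fin p₂ → Finset (Fin 4)} {sb₂ : Fin q₂ → Finset (Fin 4)}
/-- **The (W1) family certificate in sector coordinates**: for integer array families `α, β` (sector 1), `γ, δ`
(sector 2), an integer trial table `y` and a rational energy `et/den`, with kernel-evaluated pairing `P`, squared
residual `R` (scaled by `den`) and `Yn = Σ y²`:
`(θ₁+θ₂-E)·|Σ_{k',k} K(E; Γα_{k'}, Γβ_k; Γγ_{k'}, Γδ_k) - P| ≤ (Σ_{k'} ‖Γα_{k'}‖‖Γγ_{k'}‖)·(√R/den + |E - et/den|·√Yn)`. [folklore] -/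
theorem sector_family_certificate
    (ha₁ : IsSubsetEnum a₁ sa₁) (hb₁ : IsSubsetEnum b₁ sb₁) (ha₂ : IsSubsetEnum a₂ sa₂) (hb₂ : IsSubsetEnum b₂ sb₂)
    {Ka₁ : Fin p₁ → Fin p₁ → ℤ} {Kb₁ : Fin q₁ → Fin q₁ → ℤ} {d₁ : Fin p₁ → Fin q₁ → ℕ}
    {Ka₂ : Fin p₂ → Fin p₂ → ℤ} {Kb₂ : Fin q₂ → Fin q₂ → ℤ} {d₂ : Fin p₂ → Fin q₂ → ℕ}
    (hKa₁ : ∀ i i', hoppingMatrix plaqGraph4 1 (sa₁ i) (sa₁ i') = (Ka₁ i i' : ℂ))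
    (hKb₁ : ∀ j j', hoppingMatrix plaqGraph4 1 (sb₁ j) (sb₁ j') = (Kb₁ j j' : ℂ))
    (hd₁ : ∀ i j, (sa₁ i ∩ sb₁ j).card = d₁ i j)
    (hKa₂ : ∀ i i', hoppingMatrix plaqGraph4 1 (sa₂ i) (sa₂ i') = (Ka₂ i i' : ℂ))
    (hKb₂ : ∀ j j', hoppingMatrix plaqGraph4 1 (sb₂ j) (sb₂ j') = (Kb₂ j j' : ℂ))
    (hd₂ : ∀ i j, (sa₂ i ∩ sb₂ j).card = d₂ i j)
    {θ₁ θ₂ E : ℝ}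
    (hθ₁ : ∀ v : Fock (Orb PlaquetteSite), IsInSector a₁ b₁ v →
      θ₁ * (star v ⬝ᵥ v).re ≤ (star v ⬝ᵥ (plaquetteHamiltonian 2 *ᵥ v)).re)
    (hθ₂ : ∀ v : Fock (Orb PlaquetteSite), IsInSector a₂ b₂ v →
      θ₂ * (star v ⬝ᵥ v).re ≤ (star v ⬝ᵥ (plaquetteHamiltonian 2 *ᵥ v)).re)
    (hE : E < θ₁ + θ₂)
    (α β : Fin 2 → Fin p₁ → Fin q₁ → ℤ) (γ δ : Fin 2 → Fin p₂ → Fin q₂ → ℤ)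
    (y : Fin p₁ → Fin q₁ → Fin p₂ → Fin q₂ → ℤ) (et : ℤ) {den : ℕ} (hden : 0 < den) {P R Yn : ℤ}
    (hP : (∑ k : Fin 2, ∑ i, ∑ j, ∑ i', ∑ j', α k i j * y i j i' j' * γ k i' j') = P)
    (hR : (∑ i, ∑ j, ∑ i', ∑ j',
      ((den : ℤ) * (∑ k : Fin 2, δ k i' j' * β k i j) -
        ((den : ℤ) * ((∑ i₂, Ka₁ i i₂ * y i₂ j i' j') + (∑ j₂, Kb₁ j j₂ * y i j₂ i' j') + 2 * (d₁ i j : ℤ) * y i j i' j' +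
          ((∑ i₂, Ka₂ i' i₂ * y i j i₂ j') + (∑ j₂, Kb₂ j' j₂ * y i j i' j₂) + 2 * (d₂ i' j' : ℤ) * y i j i' j')) -
          et * y i j i' j')) ^ 2) = R)
    (hYn : (∑ i, ∑ j, ∑ i', ∑ j', y i j i' j' ^ 2) = Yn) :
    (θ₁ + θ₂ - E) *
        ‖(∑ k' : Fin 2, ∑ k : Fin 2, pairResolvent (plaquetteHamiltonian_isHermitian 2) E
            (gam *ᵥ ofSectorArray sa₁ sb₁ (fun i j => ((α k' i j : ℤ) : ℂ)))
            (gam *ᵥ ofSectorArray sa₁ sb₁ (fun i j => ((β k i j : ℤ) : ℂ)))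
            (gam *ᵥ ofSectorArray sa₂ sb₂ (fun i j => ((γ k' i j : ℤ) : ℂ)))
            (gam *ᵥ ofSectorArray sa₂ sb₂ (fun i j => ((δ k i j : ℤ) : ℂ)))) - (P : ℂ)‖ ≤
      (∑ k' : Fin 2, eucNorm (gam *ᵥ ofSectorArray sa₁ sb₁ (fun i j => ((α k' i j : ℤ) : ℂ))) *
          eucNorm (gam *ᵥ ofSectorArray sa₂ sb₂ (fun i j => ((γ k' i j : ℤ) : ℂ)))) *
        (Real.sqrt R / den + |E - et / den| * Real.sqrt Yn) := by
  set H : Matrix (Finset (Orb PlaquetteSite)) (Finset (Orb PlaquetteSite)) ℂ := plaquetteHamiltonian 2 with hHdef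
  set av : Fin 2 → Fock (Orb PlaquetteSite) := fun k => gam *ᵥ ofSectorArray sa₁ sb₁ (fun i j => ((α k i j : ℤ) : ℂ))
    with hav
  set bv : Fin 2 → Fock (Orb PlaquetteSite) := fun k => gam *ᵥ ofSectorArray sa₁ sb₁ (fun i j => ((β k i j : ℤ) : ℂ))
    with hbv
  set cv : Fin 2 → Fock (Orb PlaquetteSite) := fun k => gam *ᵥ ofSectorArray sa₂ sb₂ (fun i j => ((γ k i j : ℤ) : ℂ))
    with hcv
  set dv : Fin 2 → Fock (Orb PlaquetteSite) := fun k => gam *ᵥ ofSectorArray sa₂ sb₂ (fun i j => ((δ k i j : ℤ) : ℂ))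
    with hdv
  set f : Fin p₂ × Fin q₂ → Fock (Orb PlaquetteSite) :=
    fun J => gam *ᵥ ofSectorArray sa₂ sb₂ (fun i j => if i = J.1 ∧ j = J.2 then (1 : ℂ) else 0) with hf
  set yv : Fin p₂ × Fin q₂ → Fock (Orb PlaquetteSite) :=
    fun J => gam *ᵥ ofSectorArray sa₁ sb₁ (fun i j => ((y i j J.1 J.2 : ℤ) : ℂ)) with hyv
  set Y : Matrix (Finset (Orb PlaquetteSite)) (Finset (Orb PlaquetteSite)) ℂ := ∑ J, vecMulVec (yv J) (f J) with hY
  have hK₁ := plaquetteHamiltonian_block 2 a₁ b₁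
  have hK₂ := plaquetteHamiltonian_block 2 a₂ b₂
  have hθ₁' : ∀ u : Fock (Orb PlaquetteSite), (∀ j, ¬ ((upPart j).card = a₁ ∧ (downPart j).card = b₁) → u j = 0) →
      θ₁ * (star u ⬝ᵥ u).re ≤ (star u ⬝ᵥ H *ᵥ u).re := fun u hu => hθ₁ u hu
  have hθ₂' : ∀ u : Fock (Orb PlaquetteSite), (∀ j, ¬ ((upPart j).card = a₂ ∧ (downPart j).card = b₂) → u j = 0) →
      θ₂ * (star u ⬝ᵥ u).re ≤ (star u ⬝ᵥ H *ᵥ u).re := fun u hu => hθ₂ u hu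
  have hsa : ∀ k j, ¬ ((upPart j).card = a₁ ∧ (downPart j).card = b₁) → av k j = 0 :=
    fun k => isInSector_gamArray ha₁ hb₁ _
  have hsb : ∀ k j, ¬ ((upPart j).card = a₁ ∧ (downPart j).card = b₁) → bv k j = 0 :=
    fun k => isInSector_gamArray ha₁ hb₁ _
  have hsc : ∀ k j, ¬ ((upPart j).card = a₂ ∧ (downPart j).card = b₂) → cv k j = 0 :=
    fun k => isInSector_gamArray ha₂ hb₂ _
  have hsd : ∀ k j, ¬ ((upPart j).card = a₂ ∧ (downPart j).card = b₂) → dv k j = 0 :=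
    fun k => isInSector_gamArray ha₂ hb₂ _
  have hYsupp : ∀ i j, ¬ (((upPart i).card = a₁ ∧ (downPart i).card = b₁) ∧
      ((upPart j).card = a₂ ∧ (downPart j).card = b₂)) → Y i j = 0 :=
    sum_vecMulVec_support _ _ yv f (fun J => isInSector_gamArray ha₁ hb₁ _) (fun J => isInSector_gamArray ha₂ hb₂ _)
  have hcert := pairResolvent_family_certificate (plaquetteHamiltonian_isHermitian 2)
    (fun s => (upPart s).card = a₁ ∧ (downPart s).card = b₁) (fun s => (upPart s).card = a₂ ∧ (downPart s).card = b₂)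
    hK₁ hK₂ hθ₁' hθ₂' hE (a := av) (b := bv) (c := cv) (d := dv) hsa hsb hsc hsd hYsupp
  have hpair : (∑ k', ∑ i, ∑ j, star (av k' i) * star (cv k' j) * Y i j) = (P : ℂ) := by
    have step : ∀ k', (∑ i, ∑ j, star (av k' i) * star (cv k' j) * Y i j) =
        ∑ J : Fin p₂ × Fin q₂, ((∑ i, ∑ j, α k' i j * y i j J.1 J.2 : ℤ) : ℂ) * ((γ k' J.1 J.2 : ℤ) : ℂ) := by
      intro k'
      rw [hY, pairing_sum_vecMulVec]
      refine Finset.sum_congr rfl fun J _ => ?_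
      rw [hav, hyv, hcv, hf]
      simp only
      rw [star_gamArray_dotProduct ha₁ hb₁, star_gamArray_dotProduct ha₂ hb₂]
      congr 1
      · push_cast
        refine Finset.sum_congr rfl fun i _ => Finset.sum_congr rfl fun j _ => ?_
        rw [Complex.star_def, ← Complex.ofReal_intCast, Complex.conj_ofReal]
      · simp only [mul_ite, mul_one, mul_zero]
        have : ∀ i : Fin p₂, (∑ j : Fin q₂, if i = J.1 ∧ j = J.2 then star (((γ k' i j : ℤ) : ℂ)) else 0) =
            if i = J.1 then star (((γ k' i J.2 : ℤ) : ℂ)) else 0 := by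
          intro i
          by_cases hi : i = J.1
          · simp [hi]
          · simp [hi]
        simp only [this, Finset.sum_ite_eq', Finset.mem_univ, if_true]
        rw [Complex.star_def, ← Complex.ofReal_intCast, Complex.conj_ofReal]
    simp only [step]
    rw [← hP]
    push_cast
    refine Finset.sum_congr rfl fun k' _ => ?_
    calc ∑ J : Fin p₂ × Fin q₂, (∑ i, ∑ j, ((α k' i j : ℤ) : ℂ) * ((y i j J.1 J.2 : ℤ) : ℂ)) * ((γ k' J.1 J.2 : ℤ) : ℂ)
        = ∑ J : Fin p₂ × Fin q₂, ∑ i, ∑ j,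
            ((α k' i j : ℤ) : ℂ) * ((y i j J.1 J.2 : ℤ) : ℂ) * ((γ k' J.1 J.2 : ℤ) : ℂ) := by
          refine Finset.sum_congr rfl fun J _ => ?_
          rw [Finset.sum_mul]
          refine Finset.sum_congr rfl fun i _ => ?_
          rw [Finset.sum_mul]
      _ = ∑ i, ∑ J : Fin p₂ × Fin q₂, ∑ j,
            ((α k' i j : ℤ) : ℂ) * ((y i j J.1 J.2 : ℤ) : ℂ) * ((γ k' J.1 J.2 : ℤ) : ℂ) := Finset.sum_comm
      _ = ∑ i, ∑ j, ∑ J : Fin p₂ × Fin q₂,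
            ((α k' i j : ℤ) : ℂ) * ((y i j J.1 J.2 : ℤ) : ℂ) * ((γ k' J.1 J.2 : ℤ) : ℂ) :=
          Finset.sum_congr rfl fun i _ => Finset.sum_comm
      _ = ∑ i, ∑ j, ∑ i', ∑ j', ((α k' i j : ℤ) : ℂ) * ((y i j i' j' : ℤ) : ℂ) * ((γ k' i' j' : ℤ) : ℂ) :=
          Finset.sum_congr rfl fun i _ => Finset.sum_congr rfl fun j _ => by rw [Fintype.sum_prod_type]
  rw [hpair] at hcert
  refine hcert.trans (mul_le_mul_of_nonneg_left ?_ (Finset.sum_nonneg fun k' _ =>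
    mul_nonneg (eucNorm_nonneg _) (eucNorm_nonneg _)))
  have hf_H : ∀ J, H *ᵥ f J = ∑ J' : Fin p₂ × Fin q₂, ((Ka₂ J'.1 J.1 : ℂ) * (if J'.2 = J.2 then 1 else 0) +
      (Kb₂ J'.2 J.2 : ℂ) * (if J'.1 = J.1 then 1 else 0) + ((2 : ℝ) : ℂ) * (d₂ J.1 J.2 : ℂ) * (if J' = J then 1 else 0)) • f J' :=
    fun J => plaquetteHamiltonian_mulVec_gamArray_elementary ha₂ hb₂ 2 hKa₂ hKb₂ hd₂ J
  have hd_exp : ∀ k, dv k = ∑ J : Fin p₂ × Fin q₂, ((δ k J.1 J.2 : ℤ) : ℂ) • f J := fun k => gamArray_expand _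
  have hB : (∑ k, vecMulVec (bv k) (dv k)) = ∑ J, vecMulVec (∑ k, ((δ k J.1 J.2 : ℤ) : ℂ) • bv k) (f J) :=
    sum_vecMulVec_expand bv dv f (fun k J => ((δ k J.1 J.2 : ℤ) : ℂ)) hd_exp
  have hL := sylvester_sum_vecMulVec H (E : ℂ) yv f _ hf_H
  set r : Fin p₂ × Fin q₂ → Fock (Orb PlaquetteSite) := fun J =>
    (∑ k, ((δ k J.1 J.2 : ℤ) : ℂ) • bv k) - (H *ᵥ yv J + (∑ J', ((Ka₂ J.1 J'.1 : ℂ) * (if J.2 = J'.2 then 1 else 0) +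
      (Kb₂ J.2 J'.2 : ℂ) * (if J.1 = J'.1 then 1 else 0) + ((2 : ℝ) : ℂ) * (d₂ J'.1 J'.2 : ℂ) * (if J = J' then 1 else 0)) • yv J') -
      (E : ℂ) • yv J) with hr
  have hres : (∑ k, vecMulVec (bv k) (dv k)) - (H * Y + Y * Hᵀ - (E : ℂ) • Y) = ∑ J, vecMulVec (r J) (f J) := by
    rw [hB, hY, hL, sum_vecMulVec_sub]
  rw [hres]
  set zZ : Fin p₂ × Fin q₂ → Fin p₁ → Fin q₁ → ℤ := fun J i j =>
    (den : ℤ) * (∑ k : Fin 2, δ k J.1 J.2 * β k i j) -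
      ((den : ℤ) * ((∑ i₂, Ka₁ i i₂ * y i₂ j J.1 J.2) + (∑ j₂, Kb₁ j j₂ * y i j₂ J.1 J.2) + 2 * (d₁ i j : ℤ) * y i j J.1 J.2 +
        ((∑ i₂, Ka₂ J.1 i₂ * y i j i₂ J.2) + (∑ j₂, Kb₂ J.2 j₂ * y i j J.1 j₂) + 2 * (d₂ J.1 J.2 : ℤ) * y i j J.1 J.2)) -
        et * y i j J.1 J.2) with hzZ
  set ρ : Fin p₂ × Fin q₂ → Fin p₁ → Fin q₁ → ℂ := fun J i j => ((((zZ J i j : ℤ) : ℝ) / (den : ℝ) : ℝ) : ℂ) with hρ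
  set r₀ : Fin p₂ × Fin q₂ → Fock (Orb PlaquetteSite) := fun J => gam *ᵥ ofSectorArray sa₁ sb₁ (ρ J) with hr₀
  have hden' : (den : ℂ) ≠ 0 := by exact_mod_cast hden.ne'
  have hS : ∀ J : Fin p₂ × Fin q₂, (∑ k, ((δ k J.1 J.2 : ℤ) : ℂ) • bv k) =
      gam *ᵥ ofSectorArray sa₁ sb₁ (∑ k, ((δ k J.1 J.2 : ℤ) : ℂ) • fun i j => ((β k i j : ℤ) : ℂ)) := fun J => by
    rw [gamArray_sum_smul]
  have hHy : ∀ J : Fin p₂ × Fin q₂, H *ᵥ yv J = gam *ᵥ ofSectorArray sa₁ sb₁ (fun i j =>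
      (∑ i₂, (Ka₁ i i₂ : ℂ) * ((y i₂ j J.1 J.2 : ℤ) : ℂ)) + (∑ j₂, (Kb₁ j j₂ : ℂ) * ((y i j₂ J.1 J.2 : ℤ) : ℂ)) +
        ((2 : ℝ) : ℂ) * (d₁ i j : ℂ) * ((y i j J.1 J.2 : ℤ) : ℂ)) := fun J => by
    rw [hyv, hHdef, plaquetteHamiltonian_mulVec_push, hamiltonian_mulVec_ofSectorArray plaqGraph4 ha₁ hb₁ 1 2 hKa₁ hKb₁ hd₁]
  have hM : ∀ J : Fin p₂ × Fin q₂, (∑ J', ((Ka₂ J.1 J'.1 : ℂ) * (if J.2 = J'.2 then 1 else 0) +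
      (Kb₂ J.2 J'.2 : ℂ) * (if J.1 = J'.1 then 1 else 0) + ((2 : ℝ) : ℂ) * (d₂ J'.1 J'.2 : ℂ) * (if J = J' then 1 else 0)) • yv J') =
      gam *ᵥ ofSectorArray sa₁ sb₁ (∑ J', ((Ka₂ J.1 J'.1 : ℂ) * (if J.2 = J'.2 then 1 else 0) +
      (Kb₂ J.2 J'.2 : ℂ) * (if J.1 = J'.1 then 1 else 0) + ((2 : ℝ) : ℂ) * (d₂ J'.1 J'.2 : ℂ) * (if J = J' then 1 else 0)) •
        fun i j => ((y i j J'.1 J'.2 : ℤ) : ℂ)) := fun J => by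
    rw [gamArray_sum_smul]
  have hEy : ∀ (J : Fin p₂ × Fin q₂) (x : ℂ), x • yv J = gam *ᵥ ofSectorArray sa₁ sb₁ (x • fun i j => ((y i j J.1 J.2 : ℤ) : ℂ)) :=
    fun J x => by rw [ofSectorArray_smul, mulVec_smul]
  have hr0 : ∀ J, r J = r₀ J + ((E : ℂ) - (((et : ℝ) / (den : ℝ) : ℝ) : ℂ)) • yv J := by
    intro J
    rw [hr, hr₀]
    simp only
    rw [hS, hHy, hM, hEy, hEy, ← mulVec_add, ← ofSectorArray_add, ← mulVec_sub, ← ofSectorArray_sub, ← mulVec_sub,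
      ← ofSectorArray_sub, ← mulVec_add, ← ofSectorArray_add]
    congr 2
    funext i j
    simp only [Pi.add_apply, Pi.sub_apply, Finset.sum_apply, Pi.smul_apply, smul_eq_mul]
    rw [sum_sectorMatrix_apply Ka₂ Kb₂ d₂ ((2 : ℝ) : ℂ) (fun i' j' => ((y i j i' j' : ℤ) : ℂ)) J]
    simp only [hρ, hzZ]
    push_cast
    field_simp
    ring
  have hsplit : (∑ J, vecMulVec (r J) (f J)) = (∑ J, vecMulVec (r₀ J) (f J)) +
      ((E : ℂ) - (((et : ℝ) / (den : ℝ) : ℝ) : ℂ)) • Y := by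
    rw [hY, Finset.smul_sum, ← Finset.sum_add_distrib]
    refine Finset.sum_congr rfl fun J _ => ?_
    rw [hr0 J, add_vecMulVec, smul_vecMulVec]
  rw [hsplit]
  have hvec : (fun ij : Finset (Orb PlaquetteSite) × Finset (Orb PlaquetteSite) =>
      ((∑ J, vecMulVec (r₀ J) (f J)) + ((E : ℂ) - (((et : ℝ) / (den : ℝ) : ℝ) : ℂ)) • Y) ij.1 ij.2) =
      (fun ij => (∑ J, vecMulVec (r₀ J) (f J)) ij.1 ij.2) +
        ((E : ℂ) - (((et : ℝ) / (den : ℝ) : ℝ) : ℂ)) • (fun ij => Y ij.1 ij.2) := by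
    funext ij; rfl
  rw [hvec]
  refine (eucNorm_add_le _ _).trans ?_
  rw [eucNorm_smul]
  have hf_on : ∀ J J', star (f J) ⬝ᵥ f J' = if J = J' then 1 else 0 := gamArray_elementary_orthonormal ha₂ hb₂
  have hF₀ : eucNorm (fun ij : Finset (Orb PlaquetteSite) × Finset (Orb PlaquetteSite) =>
      (∑ J, vecMulVec (r₀ J) (f J)) ij.1 ij.2) ^ 2 = (R : ℝ) / ((den : ℝ) ^ 2) := by
    rw [frobenius_sum_vecMulVec_orthonormal r₀ f hf_on]
    have hJ : ∀ J, eucNorm (r₀ J) ^ 2 = ∑ i, ∑ j, (((zZ J i j : ℤ) : ℝ) / (den : ℝ)) ^ 2 := by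
      intro J
      rw [hr₀]
      simp only
      rw [eucNorm_sq, star_gamArray_dotProduct ha₁ hb₁]
      simp only [hρ, Complex.re_sum]
      refine Finset.sum_congr rfl fun i _ => Finset.sum_congr rfl fun j _ => ?_
      rw [Complex.star_def, Complex.conj_ofReal, ← Complex.ofReal_mul, Complex.ofReal_re, sq]
    simp only [hJ, div_pow]
    have hR' : (∑ i, ∑ j, ∑ i', ∑ j', (((zZ (i', j') i j : ℤ) : ℝ)) ^ 2) = (R : ℝ) := by
      have h := congrArg (fun z : ℤ => (z : ℝ)) hR
      simp only [hzZ] at h ⊢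
      push_cast at h ⊢
      exact h
    have hsum : (∑ J : Fin p₂ × Fin q₂, ∑ i, ∑ j, (((zZ J i j : ℤ) : ℝ)) ^ 2) = (R : ℝ) := by
      rw [← hR']
      calc ∑ J : Fin p₂ × Fin q₂, ∑ i, ∑ j, (((zZ J i j : ℤ) : ℝ)) ^ 2
          = ∑ i, ∑ J : Fin p₂ × Fin q₂, ∑ j, (((zZ J i j : ℤ) : ℝ)) ^ 2 := Finset.sum_comm
        _ = ∑ i, ∑ j, ∑ J : Fin p₂ × Fin q₂, (((zZ J i j : ℤ) : ℝ)) ^ 2 :=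
            Finset.sum_congr rfl fun i _ => Finset.sum_comm
        _ = ∑ i, ∑ j, ∑ i', ∑ j', (((zZ (i', j') i j : ℤ) : ℝ)) ^ 2 :=
            Finset.sum_congr rfl fun i _ => Finset.sum_congr rfl fun j _ => by rw [Fintype.sum_prod_type]
    rw [← hsum]
    simp only [Finset.sum_div]
  have hFY : eucNorm (fun ij : Finset (Orb PlaquetteSite) × Finset (Orb PlaquetteSite) => Y ij.1 ij.2) ^ 2 = (Yn : ℝ) := by
    rw [hY, frobenius_sum_vecMulVec_orthonormal yv f hf_on]
    have hJ : ∀ J, eucNorm (yv J) ^ 2 = ((∑ i, ∑ j, y i j J.1 J.2 ^ 2 : ℤ) : ℝ) := fun J => by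
      rw [hyv]; exact eucNorm_gamArray_int_sq ha₁ hb₁ _
    simp only [hJ]
    rw [← hYn]
    push_cast
    calc ∑ J : Fin p₂ × Fin q₂, ∑ i, ∑ j, (((y i j J.1 J.2 : ℤ) : ℝ)) ^ 2
        = ∑ i, ∑ J : Fin p₂ × Fin q₂, ∑ j, (((y i j J.1 J.2 : ℤ) : ℝ)) ^ 2 := Finset.sum_comm
      _ = ∑ i, ∑ j, ∑ J : Fin p₂ × Fin q₂, (((y i j J.1 J.2 : ℤ) : ℝ)) ^ 2 :=
          Finset.sum_congr rfl fun i _ => Finset.sum_comm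
      _ = ∑ i, ∑ j, ∑ i', ∑ j', (((y i j i' j' : ℤ) : ℝ)) ^ 2 :=
          Finset.sum_congr rfl fun i _ => Finset.sum_congr rfl fun j _ => by rw [Fintype.sum_prod_type]
  have h0 : eucNorm (fun ij : Finset (Orb PlaquetteSite) × Finset (Orb PlaquetteSite) =>
      (∑ J, vecMulVec (r₀ J) (f J)) ij.1 ij.2) = Real.sqrt R / den := by
    rw [← Real.sqrt_sq (eucNorm_nonneg _), hF₀, Real.sqrt_div' _ (sq_nonneg _), Real.sqrt_sq (by positivity)]
  have h1 : eucNorm (fun ij : Finset (Orb PlaquetteSite) × Finset (Orb PlaquetteSite) => Y ij.1 ij.2) = Real.sqrt Yn := by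
    rw [← Real.sqrt_sq (eucNorm_nonneg _), hFY]
  have h2 : ‖(E : ℂ) - (((et : ℝ) / (den : ℝ) : ℝ) : ℂ)‖ = |E - et / den| := by
    rw [← Complex.ofReal_sub, Complex.norm_real, Real.norm_eq_abs]
  rw [h0, h1, h2]

end Certificate

end Summit.HubbardSuperconductivity.HubbardSuperconductivity.Theorems.LevyLogBootstrap

end
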